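import Summits.QuantumFields.YangMills.Theorems.BalabanUVNodesN08HaarCompatibilityGuardJacobianContractionOperator

/-!
# BalabanUVNodes ∕ N08 — THE MONOTONE-HEIGHT PAIRING FOR EVERY `N`:
# `hs(X·e^Y, dexp(Y)(H_Y − ΣcᵢHᵢ)) ≥ (a₀(1 − Σcᵢ) − b·K∕(4a₀))·hs(X, X)` (piece (iii) of the general-`N` port of n08-w3's 30B)

WIDTH SEAT `pub-ymgap-dag-n08-w6` g6 (R399 (3a); CLAIM-1 of record HOME INBOX l.38866), 2026-08-28.  Track A, DAG node N08 = [Balaban1985UV3] Thm 1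
p. 257 (compact) + Thm 2 p. 272; [Balaban1987RG1] (0.4) p. 253; key item K1⁷ `StabilityBAtRecordR13SepCoPH` (stmt-QuantumFields-20542), `--supports … --as
helper`.  COUNT-NEUTRAL.

THE MATHEMATICS ([folklore] matrix analysis over pub-balaban's `T4EMLTangentInjective` and this lineage's g3∕g4 frame files BY IMPORT).  `Zᵢ` skew-Hermitian,
`‖Zᵢ‖ ≤ ρᵢ ≤ 1`, `cᵢ ≥ 0`, `Σcᵢ ≤ 1`, `Y = ΣcᵢZᵢ` with eigenframe `Y = U diag(−iθ) U*`, half-angles `β_{ab} = (θₐ − θ_b)∕2`, `|β_{ab}| ≤ ρ_Y := Σcᵢρᵢ`;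
`Hᵢ`, `H_Y` the solutions of `dexp(Zᵢ)Hᵢ = exp(Zᵢ)X`, `dexp(Y)H_Y = exp(Y)X`; `G := H_Y − ΣcᵢHᵢ = Q X` with `Q = φ(B_Y) − Σcᵢφ(B_{Zᵢ})` hs-symmetric,
`λ·1 ⪯ Q ⪯ (λ + b)·1`, `λ = 1 − Σcᵢ`, `b = Σcᵢψρᵢ` (g3 `jensen_hs_le`, g4 `hs_symmetrised_self_le`'s operator).  THE PAIRING of the monotone height is
  `hs(X·e^Y, dexp(Y) G) = Σ_{ab} Re( conj(X'_{ab})·ε_{ab}·G'_{ab} )`,  `ε_{ab} = e^{iθ_b}·dd(−iθₐ,−iθ_b) = e^{−iβ_{ab}}·sinc β_{ab}`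
(§2: the complex frame multiplier of `M ↦ dexp(Y)(M)·e^{−Y}`; `hs(A, M e^{−Y}) = hs(A e^{Y}, M)`).  Split `conj ε = a₀ + τ` with `a₀ ≤ Re ε` and `|τ|² ≤ K` on
`|β| ≤ ρ_Y`; then with `B = Q − λ` (symmetric psd, `⪯ b`), `p = hs(X, BX) ≥ 0`, `D² = hs(X,X)`:
  `pairing = a₀(λD² + p) + λ·hs(Φ_τX, X) + hs(Φ_τX, BX) ≥ a₀λD² + a₀p − √(bK)·D·√p ≥ (a₀λ − bK∕(4a₀))·D²`
(`hs(Φ_τX, X) = Σ Re τ·|X'|² ≥ 0`; ONE psd Cauchy–Schwarz `hs(u,Bv)² ≤ hs(u,Bu)hs(v,Bv)`, g4 `hs_symm_psd_cs`; `hs(Φ_τX,Φ_τX) ≤ K·D²`).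
  ★★★ `pairing_lower_bound`:  `(a₀(1 − Σcᵢ) − (Σcᵢψρᵢ)·K∕(4a₀))·hs(X,X) ≤ hs(X·exp Y, dexp Y (H_Y − ΣcᵢHᵢ))`
— 30B's `inner_trivialised_ge` (`N = 2`, quaternions: `c₁ = λ′a₀ − β((1−a₀)² + θ²)∕(4a₀)`) in matrix letters with the SAME shape of constant; `a₀`, `K` stay
parameters (instantiated by the consumer from `Re(e^{−iβ}sinc β) = sinc(2β) ≥ a₀`, `|e^{−iβ}sinc β − a₀|² ≤ (1 − a₀)² + sin²β·sinc²β ≤ K`).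
§4: small Hilbert–Schmidt tools for part (iv) (`hs(X,1) = 0` for skew `X`; `hs(A, Me^{−Y}) = hs(Ae^{Y}, M)`; `hs(MN,MN) ≤ ‖M‖²hs(N,N)` and
`≤ ‖N‖²hs(M,M)`, operator norm on one factor).

HONEST FRAMING.  Count-neutral helper; NO injectivity ∕ (H_K) ∕ density statement here (pieces (iv)–(v) follow); nothing of Bałaban's asserted; ONE RG step —
the k-uniform `hmass` is NOT supplied; E6′ NOT decided; N08 NOT discharged; counts unmoved (typed 28∕28 · discharged 5∕27); no summit statement is proved by this
seat — one finite 𝕋⁴ programme at fixed ε, R4 closes the CONDITIONAL rung `BalabanLadder.UV` only; the Yang–Mills mass gap (Clay) is NOT proved by any of this;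
nothing continuum ∕ ℝ⁴ ∕ OS.  0 `sorry`, 0 `def`, 0 `instance`, 0 `notation`, standard axioms.
-/

noncomputable section

open NormedSpace Finset
open scoped Matrix Matrix.Norms.L2Operator ComplexConjugate Nat

namespace Summit.QuantumFields.YangMills.BalabanUVNodes.N08HaarCompatibilityGuardMonotonePairingSUN

open Literature.MathematicalPhysics.QuantumFieldTheory.Balaban1983to89
open Literature.MathematicalPhysics.QuantumFieldTheory.Balaban1983to89.T4EMLTangentInjective
open Summit.QuantumFields.YangMills.BalabanUVNodes.N08HaarCompatibilityGuardJacobian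
open Summit.QuantumFields.YangMills.BalabanUVNodes.N08HaarCompatibilityGuardJacobianSharpFrame
open Summit.QuantumFields.YangMills.BalabanUVNodes.N08HaarCompatibilityGuardJacobianSharp
open Summit.QuantumFields.YangMills.BalabanUVNodes.N08HaarCompatibilityGuardJacobianContractionFrame
open Summit.QuantumFields.YangMills.BalabanUVNodes.N08HaarCompatibilityGuardJacobianContractionOperator
open Matrix (single diagonal unitaryGroup toEuclideanCLM)
open Complex (I)
open WithLp
open Literature.MathematicalPhysics.QuantumFieldTheory.Balaban1983to89.MatrixLog (mlog)
open T4QuatExpLog (ψ ψ_zero ψ_of_ne_zero)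

variable {m : Type*} [Fintype m] [DecidableEq m] [Nonempty m] {ι : Type*} [Fintype ι]

/-! ## §1 Complex frame multipliers: adjoint, splitting, norms -/

section Frame

variable {U : Matrix m m ℂ}

omit [Nonempty m] [Fintype ι] in
/-- The hs-adjoint of the frame multiplier with symbol `w` is the frame multiplier with symbol `conj w`. [folklore] -/
theorem hs_frameMul_adjoint (hU : star U * U = 1) (hU' : U * star U = 1) (w : m → m → ℂ) (X₁ X₂ : Matrix m m ℂ) :
    hs X₁ (U * Matrix.of (fun a b => w a b * (star U * X₂ * U) a b) * star U)
      = hs (U * Matrix.of (fun a b => star (w a b) * (star U * X₁ * U) a b) * star U) X₂ := by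
  rw [hs_frameMul_right hU hU', hs_frameMul_left hU hU']
  refine Finset.sum_congr rfl fun a _ => Finset.sum_congr rfl fun b _ => ?_
  rw [star_mul, star_star]; ring_nf

omit [DecidableEq m] [Nonempty m] [Fintype ι] in
/-- Splitting a symbol: `Φ_{w₁ + w₂} = Φ_{w₁} + Φ_{w₂}`. [folklore] -/
theorem frameMul_symbol_add (w₁ w₂ : m → m → ℂ) (X : Matrix m m ℂ) :
    U * Matrix.of (fun a b => (w₁ a b + w₂ a b) * (star U * X * U) a b) * star U
      = U * Matrix.of (fun a b => w₁ a b * (star U * X * U) a b) * star U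
        + U * Matrix.of (fun a b => w₂ a b * (star U * X * U) a b) * star U := by
  rw [← Matrix.add_mul, ← Matrix.mul_add]
  congr 2
  ext a b
  simp only [Matrix.of_apply, Matrix.add_apply, add_mul]

omit [Nonempty m] [Fintype ι] in
/-- A constant symbol acts as a scalar: `Φ_c X = c·X`. [folklore] -/
theorem frameMul_const (hU' : U * star U = 1) (c : ℂ) (X : Matrix m m ℂ) :
    U * Matrix.of (fun a b => c * (star U * X * U) a b) * star U = c • X := by
  have h : Matrix.of (fun a b => c * (star U * X * U) a b) = c • (star U * X * U) := by
    ext a b; simp only [Matrix.of_apply, Matrix.smul_apply, smul_eq_mul]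
  rw [h, Matrix.mul_smul, Matrix.smul_mul, conj_unconj hU']

omit [Nonempty m] [Fintype ι] in
/-- `hs(Φ_w X, X) = Σ Re(w_{ab})·|X'_{ab}|²`. [folklore] -/
theorem hs_frameMul_left_self (hU : star U * U = 1) (hU' : U * star U = 1) (w : m → m → ℂ) (X : Matrix m m ℂ) :
    hs (U * Matrix.of (fun a b => w a b * (star U * X * U) a b) * star U) X
      = ∑ a, ∑ b, (w a b).re * ‖(star U * X * U) a b‖ ^ 2 := by
  rw [hs_frameMul_left hU hU']
  refine Finset.sum_congr rfl fun a _ => Finset.sum_congr rfl fun b _ => ?_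
  rw [star_mul, Complex.star_def, mul_right_comm, Complex.conj_mul', ← Complex.ofReal_pow, Complex.re_ofReal_mul,
    Complex.conj_re, mul_comm]

omit [Nonempty m] [Fintype ι] in
/-- `hs(Φ_w X, Φ_w X) ≤ C·hs(X, X)` when `|w_{ab}|² ≤ C`. [folklore] -/
theorem hs_frameMul_self_le_of_sq_le (hU : star U * U = 1) (hU' : U * star U = 1) {w : m → m → ℂ} {C : ℝ}
    (hw : ∀ a b, ‖w a b‖ ^ 2 ≤ C) (X : Matrix m m ℂ) :
    hs (U * Matrix.of (fun a b => w a b * (star U * X * U) a b) * star U)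
        (U * Matrix.of (fun a b => w a b * (star U * X * U) a b) * star U) ≤ C * hs X X := by
  rw [hs_frame hU, hs_self_eq_frame hU hU' X, Finset.mul_sum]
  refine Finset.sum_le_sum fun a _ => ?_
  rw [Finset.mul_sum]
  refine Finset.sum_le_sum fun b _ => ?_
  rw [Matrix.of_apply, Complex.star_def, Complex.conj_mul', ← Complex.ofReal_pow, Complex.ofReal_re, norm_mul, mul_pow]
  exact mul_le_mul_of_nonneg_right (hw a b) (sq_nonneg _)

/-! ## §2 The pairing in the frame of `Y` -/

omit [Nonempty m] [Fintype ι] in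
/-- `X·exp Z = U·(e^{−iθ_b}·X'_{ab})·U*` in the frame of `Z`. [folklore] -/
theorem mul_exp_frame (hU : star U * U = 1) (hU' : U * star U = 1) (θ : m → ℝ) {Z : Matrix m m ℂ}
    (hZU : Z = U * diagonal (fun a => -I * (θ a : ℂ)) * star U) (X : Matrix m m ℂ) :
    X * exp Z = U * Matrix.of (fun a b => Complex.exp (-I * θ b) * (star U * X * U) a b) * star U := by
  have h1 := exp_mul_frame hU hU' θ hZU (1 : Matrix m m ℂ)
  simp only [Matrix.mul_one, hU] at h1
  have h2 : exp Z = U * diagonal (fun a => Complex.exp (-I * (θ a : ℂ))) * star U := by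
    rw [h1]; congr 2; ext a b
    simp only [Matrix.of_apply, Matrix.diagonal_apply, Matrix.one_apply]; split_ifs <;> simp
  conv_lhs => rw [(conj_unconj hU' X).symm, h2]
  rw [show U * (star U * X * U) * star U * (U * diagonal (fun a => Complex.exp (-I * (θ a : ℂ))) * star U)
      = U * ((star U * X * U) * (star U * U) * diagonal (fun a => Complex.exp (-I * (θ a : ℂ)))) * star U by
        simp only [Matrix.mul_assoc], hU, Matrix.mul_one]
  congr 2
  ext a b
  rw [Matrix.mul_diagonal, Matrix.of_apply, mul_comm]

omit [Fintype ι] in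
/-- `dexp Z G = U·(dd_{ab}·G'_{ab})·U*` in the frame of `Z`. [folklore] -/
theorem dexp_frame (hU : star U * U = 1) (hU' : U * star U = 1) (θ : m → ℝ) {Z : Matrix m m ℂ}
    (hZU : Z = U * diagonal (fun a => -I * (θ a : ℂ)) * star U) (G : Matrix m m ℂ) :
    dexp Z G = U * Matrix.of (fun a b => dd (-I * θ a) (-I * θ b) * (star U * G * U) a b) * star U := by
  have hl : ∀ a b, Z * Fu U a b = (-I * (θ a : ℂ)) • Fu U a b := fun a b => by rw [hZU]; exact frame_mul_Fu hU _ a b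
  have hr : ∀ a b, Fu U a b * Z = (-I * (θ b : ℂ)) • Fu U a b := fun a b => by rw [hZU]; exact Fu_mul_frame hU _ a b
  have hdexp : ∀ a b, dexp Z (Fu U a b) = dd (-I * θ a) (-I * θ b) • Fu U a b := fun a b => dexp_eigen (hl a b) (hr a b)
  conv_lhs => rw [(conj_unconj hU' G).symm]
  exact linmap_frame (dexp Z).toLinearMap _ hdexp _

omit [Fintype ι] in
/-- **The pairing in the frame**: `hs(X·exp Z, dexp Z G) = hs(Φ_{conj ε} X, G)`, `ε_{ab} = e^{iθ_b}·dd(−iθₐ, −iθ_b)`. [folklore] -/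
theorem hs_mul_exp_dexp (hU : star U * U = 1) (hU' : U * star U = 1) (θ : m → ℝ) {Z : Matrix m m ℂ}
    (hZU : Z = U * diagonal (fun a => -I * (θ a : ℂ)) * star U) (X G : Matrix m m ℂ) :
    hs (X * exp Z) (dexp Z G)
      = hs (U * Matrix.of (fun a b => star (Complex.exp (I * θ b) * dd (-I * θ a) (-I * θ b)) * (star U * X * U) a b)
          * star U) G := by
  rw [mul_exp_frame hU hU' θ hZU X, dexp_frame hU hU' θ hZU G, hs_frame hU, hs_frameMul_left hU hU']
  refine Finset.sum_congr rfl fun a _ => Finset.sum_congr rfl fun b _ => ?_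
  simp only [Matrix.of_apply, star_mul, star_star]
  have h1 : star (Complex.exp (-I * (θ b : ℂ))) = Complex.exp (I * θ b) := by
    rw [Complex.star_def, ← Complex.exp_conj, map_mul, map_neg, Complex.conj_I, Complex.conj_ofReal]; ring_nf
  rw [h1]; ring_nf

omit [Fintype m] [DecidableEq m] [Nonempty m] [Fintype ι] in
/-- **The symbol**: `e^{iθ_b}·dd(−iθₐ, −iθ_b) = e^{−iβ}·sinc β`, `β = (θₐ − θ_b)∕2`. [folklore] -/
theorem eps_eq (θa θb : ℝ) :
    Complex.exp (I * θb) * dd (-I * θa) (-I * θb)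
      = Complex.exp (-I * (((θa - θb) / 2 : ℝ) : ℂ)) * ((Real.sinc ((θa - θb) / 2) : ℝ) : ℂ) := by
  by_cases hab : θa = θb
  · subst hab
    have : ((θa - θa) / 2 : ℝ) = 0 := by ring
    rw [this, Real.sinc_zero, dd, if_pos rfl, ← Complex.exp_add]
    simp
  · have hβ0 : (θa - θb) / 2 ≠ 0 := by intro h; apply hab; linarith [div_eq_zero_iff.1 h]
    rw [dd_eq_exp_half_mul hab, Real.sinc_of_ne_zero hβ0, ← mul_assoc, ← Complex.exp_add]
    congr 2
    push_cast; ring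

end Frame

/-! ## §3 THE PAIRING LOWER BOUND -/
set_option maxHeartbeats 400000 in
/-- ★★★ **THE MONOTONE-HEIGHT PAIRING, EVERY `N`.**  `Zᵢ` skew-Hermitian with `‖Zᵢ‖ ≤ ρᵢ ≤ 1`, weights `cᵢ ≥ 0`, `Σcᵢ ≤ 1`, `Y = ΣcᵢZᵢ`,
`Σcᵢρᵢ ≤ ϑ`; solutions `dexp(Zᵢ)Hᵢ = exp(Zᵢ)X`, `dexp(Y)H_Y = exp(Y)X`; constants `0 < a₀` and `K` with, for all half-angles `|β| ≤ ϑ`,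
`a₀ ≤ Re(e^{−iβ}sinc β)` and `|e^{−iβ}sinc β − a₀|² ≤ K`.  Then
  `(a₀·(1 − Σcᵢ) − (Σcᵢψρᵢ)·K∕(4a₀))·hs(X, X) ≤ hs(X·exp Y, dexp Y (H_Y − ΣcᵢHᵢ))`.
PROOF.  §2 puts the pairing in `Y`'s frame with symbol `conj ε = a₀ + τ`; `H_Y − ΣcᵢHᵢ = QX`, `Q = φ(B_Y) − Σcᵢφ(B_{Zᵢ})` (g4 `solution_eq_phi_add_adh`,
`adh_sum_smul`); `B = Q − (1−Σcᵢ)` is additive, real-homogeneous, hs-symmetric (`hs_frameMul_symm`), psd (g3 `jensen_hs_le`) with `hs(x,Bx) ≤ (Σcᵢψρᵢ)hs(x,x)`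
(`ψ` monotone); then `a₀·hs(X,QX) + λ·hs(Φ_τX,X) + hs(Φ_τX,BX)` with `hs(Φ_τX,X) ≥ 0`, ONE psd Cauchy–Schwarz (g4 `hs_symm_psd_cs`) and
`hs(Φ_τX,Φ_τX) ≤ K·hs(X,X)`, and the elementary `a₀p − s ≥ −bKD²∕(4a₀)` when `s² ≤ bKD²·p`. [folklore] -/
theorem pairing_lower_bound {Z : ι → Matrix m m ℂ} (hZ : ∀ i, (Z i)ᴴ = -Z i) (ρ : ι → ℝ) (hZρ : ∀ i, ‖Z i‖ ≤ ρ i)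
    (hρ1 : ∀ i, ρ i ≤ 1) (c : ι → ℝ) (hc0 : ∀ i, 0 ≤ c i) (hc1 : ∑ i, c i ≤ 1) {ϑ : ℝ} (hϑ : ∑ i, c i * ρ i ≤ ϑ)
    {a₀ K : ℝ} (ha₀ : 0 < a₀)
    (hre : ∀ β : ℝ, |β| ≤ ϑ → a₀ ≤ (Complex.exp (-I * (β : ℂ)) * ((Real.sinc β : ℝ) : ℂ)).re)
    (hK : ∀ β : ℝ, |β| ≤ ϑ → ‖Complex.exp (-I * (β : ℂ)) * ((Real.sinc β : ℝ) : ℂ) - a₀‖ ^ 2 ≤ K)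
    (X : Matrix m m ℂ) (H : ι → Matrix m m ℂ) (HY : Matrix m m ℂ) (hH : ∀ i, dexp (Z i) (H i) = exp (Z i) * X)
    (hY : dexp (∑ i, (c i : ℂ) • Z i) HY = exp (∑ i, (c i : ℂ) • Z i) * X) :
    (a₀ * (1 - ∑ i, c i) - (∑ i, c i * ψ (ρ i)) * K / (4 * a₀)) * hs X X
      ≤ hs (X * exp (∑ i, (c i : ℂ) • Z i)) (dexp (∑ i, (c i : ℂ) • Z i) (HY - ∑ i, (c i : ℂ) • H i)) := by
  have hZ1 : ∀ i, ‖Z i‖ ≤ 1 := fun i => (hZρ i).trans (hρ1 i)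
  have hρ0 : ∀ i, 0 ≤ ρ i := fun i => (norm_nonneg _).trans (hZρ i)
  set Y : Matrix m m ℂ := ∑ i, (c i : ℂ) • Z i with hYdef
  have hYskew : Yᴴ = -Y := conjTranspose_sum_smul c hZ
  set ρY : ℝ := ∑ i, c i * ρ i with hρY
  have hYρ : ‖Y‖ ≤ ρY := by
    calc ‖Y‖ ≤ ∑ i, ‖(c i : ℂ) • Z i‖ := norm_sum_le _ _
      _ ≤ ∑ i, c i * ρ i := Finset.sum_le_sum fun i _ => by
          rw [norm_smul, Complex.norm_real, Real.norm_of_nonneg (hc0 i)]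
          exact mul_le_mul_of_nonneg_left (hZρ i) (hc0 i)
  have hρY1 : ρY ≤ 1 := by
    calc ρY = ∑ i, c i * ρ i := rfl
      _ ≤ ∑ i, c i := Finset.sum_le_sum fun i _ => by nlinarith [hc0 i, hρ1 i]
      _ ≤ 1 := hc1
  -- frames
  obtain ⟨U₀, θ₀, hU₀, hU₀', hYU, hβ₀ρ, hβ₀⟩ := exists_frame_le hYskew hYρ hρY1
  have hfr := fun i => exists_frame_le (hZ i) (hZρ i) (hρ1 i)
  choose V θ hV hV' hZV hβρ hβπ using hfr
  -- the operator `Q` and `B = Q − λ`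
  set Φ₀ : Matrix m m ℂ → Matrix m m ℂ := fun x =>
    U₀ * Matrix.of (fun a b => ((1 - ψ ((θ₀ a - θ₀ b) / 2) : ℝ) : ℂ) * (star U₀ * x * U₀) a b) * star U₀ with hΦ₀
  set Φ : ι → Matrix m m ℂ → Matrix m m ℂ := fun i x =>
    V i * Matrix.of (fun a b => ((1 - ψ ((θ i a - θ i b) / 2) : ℝ) : ℂ) * (star (V i) * x * V i) a b) * star (V i) with hΦ
  set lam : ℝ := 1 - ∑ i, c i with hlam
  have hlam0 : 0 ≤ lam := by rw [hlam]; linarith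
  set bb : ℝ := ∑ i, c i * ψ (ρ i) with hbb
  set B : Matrix m m ℂ → Matrix m m ℂ := fun x => Φ₀ x - ∑ i, (c i : ℂ) • Φ i x - (lam : ℂ) • x with hB
  -- (1) `H_Y − Σcᵢ Hᵢ = λX + B X`
  have hHY : HY = Φ₀ X + adh Y X := solution_eq_phi_add_adh hU₀ hU₀' θ₀ hβ₀ hYU X HY hY
  have hHi : ∀ i, H i = Φ i X + adh (Z i) X := fun i =>
    solution_eq_phi_add_adh (hV i) (hV' i) (θ i) (hβπ i) (hZV i) X (H i) (hH i)
  have hadh : adh Y X = ∑ i, (c i : ℂ) • adh (Z i) X := adh_sum_smul c Z X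
  have hG : HY - ∑ i, (c i : ℂ) • H i = (lam : ℂ) • X + B X := by
    rw [hB, hHY, hadh]
    simp only [hHi, smul_add, Finset.sum_add_distrib]
    abel
  -- (2) `B` is additive, homogeneous, symmetric, psd, bounded by `bb`
  have hadd : ∀ x y, B (x + y) = B x + B y := by
    intro x y
    simp only [hB, hΦ₀, hΦ, frameMul_add, smul_add, Finset.sum_add_distrib]
    abel
  have hsmul : ∀ (t : ℝ) (x : Matrix m m ℂ), B ((t : ℂ) • x) = (t : ℂ) • B x := by
    intro t x
    simp only [hB, hΦ₀, hΦ, frameMul_smul, smul_sub, Finset.smul_sum, smul_comm (c _ : ℂ) (t : ℂ), smul_comm (lam : ℂ) (t : ℂ)]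
  have hsymm : ∀ x y, hs x (B y) = hs (B x) y := by
    intro x y
    simp only [hB, hΦ₀, hΦ, hs_sub_right, hs_sub_left, hs_sum_right, hs_sum_left, hs_smul_right, hs_smul_left]
    rw [hs_frameMul_symm hU₀ hU₀']
    congr 2
    exact Finset.sum_congr rfl fun i _ => by rw [hs_frameMul_symm (hV i) (hV' i)]
  have hQform : ∀ x, hs x (B x) = hs x (Φ₀ x) - ∑ i, c i * hs x (Φ i x) - lam * hs x x := by
    intro x
    simp only [hB, hs_sub_right, hs_sum_right, hs_smul_right]
  have hpos : ∀ x, 0 ≤ hs x (B x) := by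
    intro x
    have hsolY := dexp_phi_add_adh hU₀ hU₀' θ₀ hβ₀ hYU x
    have hsoli := fun i => dexp_phi_add_adh (hV i) (hV' i) (θ i) (hβπ i) (hZV i) x
    have hj := jensen_hs_le hZ hZ1 c hc0 hc1 x (fun i => Φ i x + adh (Z i) x) (Φ₀ x + adh Y x) hsoli hsolY
    have e1 : hs x (Φ₀ x + adh Y x) = hs x (Φ₀ x) := by rw [hs_add_right, hs_adh_self hYskew, add_zero]
    have e2 : ∀ i, hs x (Φ i x + adh (Z i) x) = hs x (Φ i x) := fun i => by
      rw [hs_add_right, hs_adh_self (hZ i), add_zero]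
    simp only [e1, e2] at hj
    rw [hQform, hlam]
    linarith
  have hup : ∀ x, hs x (B x) ≤ bb * hs x x := by
    intro x
    have h0 : hs x (Φ₀ x) ≤ hs x x := hs_frameMul_self_le hU₀ hU₀' (fun a b => one_sub_ψ_le_one (hβ₀ a b)) x
    have hi : ∀ i, (1 - ψ (ρ i)) * hs x x ≤ hs x (Φ i x) := fun i =>
      hs_frameMul_self_ge (hV i) (hV' i) (fun a b => by
        have hρπ : ρ i < Real.pi := by linarith [hρ1 i, Real.pi_gt_three]
        linarith [ψ_le_ψ_of_abs_le (hβρ i a b) hρπ]) x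
    have h2 : ∑ i, c i * (1 - ψ (ρ i)) * hs x x ≤ ∑ i, c i * hs x (Φ i x) := Finset.sum_le_sum fun i _ => by
      rw [mul_assoc]; exact mul_le_mul_of_nonneg_left (hi i) (hc0 i)
    have e3 : ∑ i, c i * (1 - ψ (ρ i)) * hs x x = (∑ i, c i) * hs x x - bb * hs x x := by
      rw [hbb, Finset.sum_mul, Finset.sum_mul, ← Finset.sum_sub_distrib]
      exact Finset.sum_congr rfl fun i _ => by ring
    rw [hQform, hlam]
    linarith
  -- (3) the symbol of the pairing, split as `a₀ + τ`
  set ε : m → m → ℂ := fun a b => Complex.exp (I * θ₀ b) * dd (-I * θ₀ a) (-I * θ₀ b) with hε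
  set τ : m → m → ℂ := fun a b => star (ε a b) - a₀ with hτ
  have hεβ : ∀ a b, ε a b = Complex.exp (-I * ((((θ₀ a - θ₀ b) / 2 : ℝ)) : ℂ)) * ((Real.sinc ((θ₀ a - θ₀ b) / 2) : ℝ) : ℂ) :=
    fun a b => eps_eq (θ₀ a) (θ₀ b)
  have hβϑ : ∀ a b, |(θ₀ a - θ₀ b) / 2| ≤ ϑ := fun a b => (hβ₀ρ a b).trans hϑ
  have hτre : ∀ a b, 0 ≤ (τ a b).re := fun a b => by
    simp only [hτ, Complex.sub_re, Complex.star_def, Complex.conj_re, Complex.ofReal_re]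
    have := hre _ (hβϑ a b); rw [← hεβ] at this; linarith
  have hτK : ∀ a b, ‖τ a b‖ ^ 2 ≤ K := fun a b => by
    have h1 := hK _ (hβϑ a b); rw [← hεβ] at h1
    have h2 : ‖τ a b‖ = ‖ε a b - a₀‖ := by
      show ‖star (ε a b) - (a₀ : ℂ)‖ = _
      rw [show star (ε a b) - (a₀ : ℂ) = star (ε a b - a₀) by rw [star_sub, Complex.star_def, Complex.conj_ofReal],
        Complex.star_def, Complex.norm_conj]
    rw [h2]; exact h1
  set Tτ : Matrix m m ℂ := U₀ * Matrix.of (fun a b => τ a b * (star U₀ * X * U₀) a b) * star U₀ with hTτ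
  have hpair : hs (X * exp Y) (dexp Y (HY - ∑ i, (c i : ℂ) • H i))
      = a₀ * hs X ((lam : ℂ) • X + B X) + hs Tτ ((lam : ℂ) • X + B X) := by
    rw [hs_mul_exp_dexp hU₀ hU₀' θ₀ hYU, hG]
    have hsplit : (fun a b => star (Complex.exp (I * θ₀ b) * dd (-I * θ₀ a) (-I * θ₀ b)) * (star U₀ * X * U₀) a b)
        = (fun a b => ((a₀ : ℂ) + τ a b) * (star U₀ * X * U₀) a b) := by
      ext a b; simp only [hτ, hε]; ring
    rw [hsplit, frameMul_symbol_add, frameMul_const hU₀', hs_add_left, hs_smul_left]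
  -- (4) the three pieces
  have hXX := hs_self_nonneg X
  set p : ℝ := hs X (B X) with hp
  have hp0 : 0 ≤ p := hpos X
  have hs1 : hs X ((lam : ℂ) • X + B X) = lam * hs X X + p := by rw [hs_add_right, hs_smul_right]
  have hs2 : hs Tτ ((lam : ℂ) • X + B X) = lam * hs Tτ X + hs Tτ (B X) := by rw [hs_add_right, hs_smul_right]
  have hTX : 0 ≤ hs Tτ X := by
    rw [hTτ, hs_frameMul_left_self hU₀ hU₀']
    exact Finset.sum_nonneg fun a _ => Finset.sum_nonneg fun b _ => mul_nonneg (hτre a b) (sq_nonneg _)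
  have hTT : hs Tτ Tτ ≤ K * hs X X := hs_frameMul_self_le_of_sq_le hU₀ hU₀' hτK X
  have hCS : hs Tτ (B X) * hs Tτ (B X) ≤ hs Tτ (B Tτ) * p := hs_symm_psd_cs hadd hsmul hsymm hpos Tτ X
  have hTB : hs Tτ (B Tτ) ≤ bb * (K * hs X X) := (hup Tτ).trans (mul_le_mul_of_nonneg_left hTT (by
    rw [hbb]; exact Finset.sum_nonneg fun i _ => mul_nonneg (hc0 i)
      (ψ_nonneg_of_abs_lt_pi (by rw [abs_of_nonneg (hρ0 i)]; linarith [hρ1 i, Real.pi_gt_three]))))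
  -- (5) `a₀ p + s ≥ −bb·K·D²/(4a₀)` from `s² ≤ bb K D² p`
  set s : ℝ := hs Tτ (B X) with hsdef
  have hs_sq : s * s ≤ bb * K * hs X X * p := by nlinarith
  have hkey : -(bb * K / (4 * a₀)) * hs X X ≤ a₀ * p + s := by
    by_cases hp00 : p = 0
    · have hs0 : s = 0 := by
        have : s * s ≤ 0 := by rw [hp00, mul_zero] at hs_sq; exact hs_sq
        nlinarith
      rw [hp00, hs0]
      have : 0 ≤ bb * K / (4 * a₀) * hs X X := by
        have hbK : 0 ≤ bb * K * hs X X * p := le_trans (mul_self_nonneg s) hs_sq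
        rw [hp00] at hbK
        -- need 0 ≤ bb * K * hs X X: from hTB and hpos
        have h1 : 0 ≤ bb * (K * hs X X) := (hpos Tτ).trans hTB
        have : bb * K / (4 * a₀) * hs X X = bb * (K * hs X X) / (4 * a₀) := by ring
        rw [this]; positivity
      linarith
    · have hp_pos : 0 < p := lt_of_le_of_ne hp0 (Ne.symm hp00)
      -- `p·(4a₀²p + 4a₀ s + bbK D²) ≥ (2a₀p + s)² ≥ 0`
      have h1 : 0 ≤ p * (4 * a₀ ^ 2 * p + 4 * a₀ * s + bb * K * hs X X) := by
        nlinarith [sq_nonneg (2 * a₀ * p + s)]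
      have h2 : 0 ≤ 4 * a₀ ^ 2 * p + 4 * a₀ * s + bb * K * hs X X := (mul_nonneg_iff_of_pos_left hp_pos).mp h1
      have h3 : -(bb * K / (4 * a₀)) * hs X X = -(bb * K * hs X X) / (4 * a₀) := by ring
      rw [h3, div_le_iff₀ (by positivity)]
      nlinarith
  -- (6) assemble
  rw [hpair, hs1, hs2]
  have h4 : (a₀ * (1 - ∑ i, c i) - bb * K / (4 * a₀)) * hs X X
      = a₀ * (lam * hs X X) + -(bb * K / (4 * a₀)) * hs X X := by rw [hlam]; ring
  rw [h4]
  nlinarith [mul_nonneg hlam0 hTX]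

/-! ## §4 Tools for the height (part (iv)): `hs(X,1) = 0` for skew `X`, `hs(A, Me^{−Y}) = hs(Ae^{Y}, M)`, `hs(BR,BR) ≤ ‖R‖²hs(B,B)` -/

omit [Nonempty m] [Fintype ι] in
/-- `hs X 1 = 0` for skew-Hermitian `X` (`tr X` is imaginary). [folklore] -/
theorem hs_one_of_skew {X : Matrix m m ℂ} (hX : Xᴴ = -X) : hs X 1 = 0 := by
  have h1 : hs X 1 = (Matrix.trace X).re := by
    simp only [hs, hsC, Matrix.mul_one, Matrix.trace_conjTranspose, Complex.star_def, Complex.conj_re]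
  have h2 : hs X 1 = -(Matrix.trace X).re := by
    simp only [hs, hsC, Matrix.mul_one, hX, Matrix.trace_neg, Complex.neg_re]
  linarith

omit [Nonempty m] [Fintype ι] in
/-- `hs(A, M·e^{−Y}) = hs(A·e^{Y}, M)` for skew-Hermitian `Y` (`(e^{Y})ᴴ = e^{−Y}`). [folklore] -/
theorem hs_mul_exp_neg (A M : Matrix m m ℂ) {Y : Matrix m m ℂ} (hY : Yᴴ = -Y) : hs A (M * exp (-Y)) = hs (A * exp Y) M := by
  letI : NormedAlgebra ℚ (Matrix m m ℂ) := NormedAlgebra.restrictScalars ℚ ℂ (Matrix m m ℂ)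
  have h1 : (exp Y)ᴴ = exp (-Y) := by rw [← Matrix.star_eq_conjTranspose, star_exp, Matrix.star_eq_conjTranspose, hY]
  unfold hs
  rw [hsC_mul_right, h1]

omit [Nonempty m] [Fintype ι] in
/-- `hs(M N, M N) ≤ ‖M‖²·hs(N, N)` (operator norm on the left factor; column by column). [folklore] -/
theorem hs_mul_self_le_opNorm_left (M N : Matrix m m ℂ) : hs (M * N) (M * N) ≤ ‖M‖ ^ 2 * hs N N := by
  rw [hs_self, hs_self, Finset.sum_comm]
  conv_rhs => rw [Finset.sum_comm]
  rw [Finset.mul_sum]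
  refine Finset.sum_le_sum fun b _ => ?_
  have h1 : ∑ a, ‖(M * N) a b‖ ^ 2 = ‖toEuclideanCLM (n := m) (𝕜 := ℂ) M (toLp 2 fun j => N j b)‖ ^ 2 := by
    rw [EuclideanSpace.norm_sq_eq]
    simp only [Matrix.toEuclideanCLM_toLp, PiLp.toLp_apply, Matrix.mulVec, dotProduct, Matrix.mul_apply]
  have h2 : ∑ a, ‖N a b‖ ^ 2 = ‖(toLp 2 fun j => N j b : EuclideanSpace ℂ m)‖ ^ 2 := by
    rw [EuclideanSpace.norm_sq_eq]
  rw [h1, h2, ← mul_pow, ← Matrix.l2_opNorm_toEuclideanCLM]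
  exact pow_le_pow_left₀ (norm_nonneg _) (ContinuousLinearMap.le_opNorm _ _) 2

omit [Nonempty m] [Fintype ι] in
/-- `hs(B R, B R) ≤ ‖R‖²·hs(B, B)` (operator norm on the right factor). [folklore] -/
theorem hs_mul_self_le_opNorm_right (B R : Matrix m m ℂ) : hs (B * R) (B * R) ≤ ‖R‖ ^ 2 * hs B B := by
  have h1 : ∀ A : Matrix m m ℂ, hs Aᴴ Aᴴ = hs A A := fun A => by
    rw [hs_self, hs_self, Finset.sum_comm]
    simp [Matrix.conjTranspose_apply]
  rw [← h1 (B * R), Matrix.conjTranspose_mul, ← h1 B, ← Matrix.l2_opNorm_conjTranspose R]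
  exact hs_mul_self_le_opNorm_left _ _

end Summit.QuantumFields.YangMills.BalabanUVNodes.N08HaarCompatibilityGuardMonotonePairingSUN
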